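import Literature.IUT.HodgeArakelov.TwoSectionsNonVacuity
import Literature.IUT.HodgeArakelov.TwoSectionsRigidityConvention
import HarnessLib

/-!
# [IUTchII] Rmk. 1.1.1 (iii), last sentence, AT THE GENUINE FRAME: the two sections PINNED and the Def. 1.1 (ii)
# datum that IS their difference (`rigidity_is_difference` PROVED) — pinned-sections variant of `TwoSectionsNonVacuity`

Mochizuki, *Inter-universal Teichmüller theory II*, §1, Remark 1.1.1 (iii), kurims manuscript (Dec. 2020) p. 23 l. 3–6
[claim: Mochizuki2012, status: disputed] (IUTchII §1 Rmk 1.1.1 (iii), kurims p.23): «The mono-theta-theoretic cyclotomic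
rigidity isomorphism of Definition 1.1, (ii), is then reconstructed [cf. [EtTh], Corollary 2.19, (i)] by forming the
difference of the two sections `s^Θ(M^Θ)|_{(l·Δ_Θ)}`, `s^alg(M^Θ)|_{(l·Δ_Θ)}`»; [EtTh] Cor. 2.19 (i), kurims p. 58 l. 47–52
«two splittings … — hence, in particular, [by forming the difference of these two splittings] an isomorphism of
cyclotomes» [cite: MochizukiEtTh2009, Cor 2.19(i) p.64]. abc-iut cell, layer L6, seat abc-iut-w4-d043 (gen 6), by-name
row «IUTchII-§1-REMARKS-COVERAGE» (L6-lead gen 4), node **IUTchII:Rmk1.1.1(iii)**; abc-iut-L6-t1 typed the sentence as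
`rigidity_is_difference Sec C` (`MonoThetaSymmetries.lean`, p405595, FROZEN): for lifts `t ∈ s^Θ`, `s ∈ s^alg` over `a`,
`C.iso[a] = t · s⁻¹`. PROOF-ONLY (0 `def`/`structure`/`instance`).

`ModelFrame.exists_twoSections_rigidity_of_coreTower`: over the [EtTh] model frame, under EXACTLY the binders of
abc-iut-w5-d225's `exists_twoSections_of_coreTower` (p437698) with the theta cocycle `η` made explicit, there are the model
theta-quotient datum `T` (abc-iut-w4-d030: `T.thetaSection = e⁻¹(s^alg(thetaKer))`), a two-sections datum
`Sec : TwoSections T W` — p437698's GENUINE construction REPEATED verbatim inside the proof (an `∃`-statement does not expose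
its witness; precedent: abc-iut-w4-d019's p442142 repeats p437733) so that the statement PINS the sections: (P1) the class
of `e⁻¹(s^Θ_η g)` lies in `Sec.sTheta` for every `g` in the `(l·Δ_Θ)`-preimage, (P2) every element of `Sec.sAlg` is the
class of some `e⁻¹(s^alg g)` — and a Def. 1.1 (ii) datum `C′ : CyclotomicRigidity (F.reconstruction e)` with
`C′.iso = (B8 iso)⁻¹` POINTWISE in `Π_M` (B8 = abc-iut-L2-t2's convention `s^alg · (s^Θ)⁻¹ = ι_μ ∘ thetaMod`; inversion
of the abelian `Π_μ(M)` is equivariant, `CyclotomicRigidity` pins no sign, print fixes none) such that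
**`rigidity_is_difference Sec C′` HOLDS** (value: abc-iut-w5-d225's `sTheta_mul_sAlg_inv_eq_iso_inv`, p441478). Sequel:
`Rmk111StructuresGenuine.lean` (convention theorem, `Rmk111_structures` at the genuine frame). No `Prop` fact introduced,
no FACT-LIST row consumed; binders = p437698's + `η`. HONEST FRAMING: kernel facts about the cell's own interfaces and
model; Rmk. 1.1.1 lies outside the [IUTchIII] Cor. 3.12 cone; no side taken on Cor. 3.12; typed ≠ proved.
-/

noncomputable section

namespace Literature.IUT.HodgeArakelov

open Literature.AnabelianGeometry.EtaleTheta Literature.AnabelianGeometry.SemiGraphs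
open scoped Literature.AnabelianGeometry.EtaleTheta

namespace ModelFrame

variable {p : ℕ} [Fact p.Prime] {Mt : MuTwoSetting p}
  {E : Mt.toThetaSetting.EtaleThetaData} {l : ℕ} (C : E.DoubleUnderline l)
  {S : ThetaSetting.{0}} (μ : Mt.toThetaSetting.CyclotomeMod l S.N)
  (hC : Mt.toThetaSetting.Compat) (hS : Mt.toThetaSetting.Sec2Hyps)
  (h15 : ThetaSetting.Prop15iii E hC) (L : C.CuspLabels)
  (F : ModelFrame S (C.rigidData μ hC hS h15 L)) {Menv : MonoThetaEnv S}
  (e : Menv.Pi ≃ₜ* (C.rigidData μ hC hS h15 L).env)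

/-- **IUTchII:Rmk1.1.1(iii), last sentence, at the GENUINE frame — pinned two sections and the difference-convention
Def. 1.1 (ii) datum `C′` with `rigidity_is_difference Sec C′`.** Binders = abc-iut-w5-d225's `exists_twoSections_of_coreTower`
(p437698) with the theta cocycle `η` explicit; the construction of `T`, `Sec` is p437698's verbatim. Conjuncts: the `T` pin;
`C′.iso = (B8 iso)⁻¹` pointwise in `Π_M`; `rigidity_is_difference Sec C′`; (P1) the class of `e⁻¹(s^Θ_η g)` lies in `Sec.sTheta`;
(P2) every element of `Sec.sAlg` is the class of some `e⁻¹(s^alg g)`. [claim: Mochizuki2012, status: disputed] (IUTchII §1 Rmk 1.1.1 (iii), kurims pp.22-23) -/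
theorem exists_twoSections_rigidity_of_coreTower (hO : Mt.toThetaSetting.IsEtThOrigin)
    (hYcl : (Mt.DtpY.map Mt.toHat.toMonoidHom).topologicalClosure ≤
      Mt.DtpY.map Mt.toHat.toMonoidHom ⊔ (⁅⁅Mt.DeltaHat, Mt.DeltaHat⁆, Mt.DeltaHat⁆).topologicalClosure)
    {η : (C.rigidData μ hC hS h15 L).PiYdd → (C.rigidData μ hC hS h15 L).mu}
    (hη : η ∈ (C.rigidData μ hC hS h15 L).thetaCocycles)
    (W : CoreTower (F.reconstruction e))
    (hWker : W.kerEll = ((Mt.thetaToEll.comp Mt.toTheta).ker).comap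
      (C.Huu.subtype.comp (Mt.GtpY.subgroupOf C.Huu).subtype)) :
    ∃ (T : ThetaQuotientData (F.reconstruction e)) (Sec : TwoSections T W)
      (C' : CyclotomicRigidity (F.reconstruction e)),
      T.thetaSection = (((C.rigidData μ hC hS h15 L).thetaKer.subgroupOf (C.rigidData μ hC hS h15 L).PiY).map
          (CycEnvelope.algSection (C.rigidData μ hC hS h15 L).augY (C.rigidData μ hC hS h15 L).chi)).comap
          e.toMulEquiv.toMonoidHom ∧
      (∀ c, ((C'.iso c : ↥(F.reconstruction e).extCyc) : Menv.Pi) =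
        (((F.cyclotomicRigidity e).iso c : ↥(F.reconstruction e).extCyc) : Menv.Pi)⁻¹) ∧
      rigidity_is_difference Sec C' ∧
      (∀ g : ↥(C.rigidData μ hC hS h15 L).lDeltaTheta,
        ∃ hg : e.symm ((C.rigidData μ hC hS h15 L).toThetaEnvData.sTheta hη
            ⟨(g : (C.rigidData μ hC hS h15 L).PiX),
              (Subgroup.mem_inf.1 ((C.rigidData μ hC hS h15 L).lDeltaTheta_le g.2)).1⟩) ∈ T.envAtTheta.top,
          (QuotientGroup.mk (⟨_, hg⟩ : ↥T.envAtTheta.top) : T.envAtTheta.carrier) ∈ Sec.sTheta) ∧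
      (∀ s ∈ Sec.sAlg, ∃ (g : ↥(C.rigidData μ hC hS h15 L).lDeltaTheta)
        (hg : e.symm ((C.rigidData μ hC hS h15 L).toThetaEnvData.sAlg
            ⟨(g : (C.rigidData μ hC hS h15 L).PiX),
              (Subgroup.mem_inf.1 ((C.rigidData μ hC hS h15 L).lDeltaTheta_le g.2)).1⟩) ∈ T.envAtTheta.top),
          s = (QuotientGroup.mk (⟨_, hg⟩ : ↥T.envAtTheta.top) : T.envAtTheta.carrier)) := by
  classical
  set R : RigidData S.N l := C.rigidData μ hC hS h15 L with hRdef
  obtain ⟨T, hTker, hTsec, hText⟩ := ModelFrame.exists_thetaQuotientData_model F e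
  haveI hinclYn : (F.reconstruction e).inclY.range.Normal := (F.reconstruction e).inclY_normal
  haveI hkerElln : W.kerEll.Normal := W.kerEll_normal
  haveI hdeltaElln : (W.kerEll.subgroupOf (F.reconstruction e).DeltaY).Normal := W.deltaEll_normal
  have haugR : ∀ x : ↥C.Huu, x ∈ R.aug.ker ↔ Mt.aug (x : Mt.PiTemp) = 1 := fun x => by
    rw [MonoidHom.mem_ker, ← OneMemClass.coe_eq_one]; rfl
  have hlDT_PiY : R.lDeltaTheta ≤ R.PiY := fun t ht => R.PiYdd_le (R.lDeltaTheta_le ht).1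
  have hlDT_PiYdd : R.lDeltaTheta ≤ R.PiYdd := fun t ht => (R.lDeltaTheta_le ht).1
  have hmemL : ∀ t : ↥C.Huu, t ∈ R.lDeltaTheta ↔ Mt.toTheta (t : Mt.PiTemp) ∈ Mt.lDeltaTheta l :=
    fun _ => Iff.rfl
  have hmemK : ∀ t : ↥C.Huu, t ∈ R.thetaKer ↔ Mt.toTheta (t : Mt.PiTemp) = 1 := fun _ => Iff.rfl
  have hcomm := C.rigidData_hcomm_of_origin μ hC hS h15 L hO hYcl
  have hΔY : ∀ y : ↥(F.reconstruction e).DeltaY,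
      Mt.aug (((y : ↥(Mt.GtpY.subgroupOf C.Huu)) : ↥C.Huu) : Mt.PiTemp) = 1 := fun y =>
    (mem_deltaY_reconstruction_iff C μ hC hS h15 L F e y.1).1 y.2
  have hcent : ∀ c ∈ Mt.DeltaTheta, ∀ g ∈ (Mt.aug.toMonoidHom.ker).map Mt.toTheta, c * g = g * c :=
    fun c hc g hg => Mt.ker_thetaToEll_central c hc g hg
  have hcommΘ : ∀ c₁ ∈ Mt.DeltaTheta, ∀ c₂ ∈ Mt.DeltaTheta, c₁ * c₂ = c₂ * c₁ :=
    fun c₁ h₁ c₂ h₂ => Mt.ker_thetaToEll_comm c₁ h₁ c₂ h₂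
  have hYab : ∀ h₁ ∈ Mt.DtpYTheta, ∀ h₂ ∈ Mt.DtpYTheta, h₁ * h₂ = h₂ * h₁ :=
    Mt.toThetaSetting.dtpYTheta_comm hO
  have hθΔ : ∀ x : ↥C.Huu, Mt.aug (x : Mt.PiTemp) = 1 →
      Mt.toTheta (x : Mt.PiTemp) ∈ (Mt.aug.toMonoidHom.ker).map Mt.toTheta := fun x hx =>
    Subgroup.mem_map_of_mem _ (by exact hx)
  have hθY : ∀ b : ↥(Mt.GtpY.subgroupOf C.Huu), Mt.aug ((b : ↥C.Huu) : Mt.PiTemp) = 1 →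
      Mt.toTheta ((b : ↥C.Huu) : Mt.PiTemp) ∈ Mt.DtpYTheta := fun b hb =>
    Subgroup.mem_map_of_mem _ ⟨Subgroup.mem_subgroupOf.1 b.2, hb⟩
  have hYΔ : Mt.DtpYTheta ≤ (Mt.aug.toMonoidHom.ker).map Mt.toTheta := Subgroup.map_mono inf_le_right
  have htop : ∀ m : Menv.Pi, m ∈ T.envAtTheta.top ↔
      (((F.reconstruction e).projY m : ↥R.PiY) : ↥C.Huu) ∈ R.lDeltaTheta := fun m => Iff.rfl
  have hbot : ∀ m : Menv.Pi, m ∈ T.envAtTheta.bot ↔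
      e m ∈ ((R.thetaKer.subgroupOf R.PiY).map (CycEnvelope.algSection R.augY R.chi)) := fun m => by
    change m ∈ T.thetaSection ↔ _; rw [hTsec]; rfl
  have hprojY : ∀ m : Menv.Pi, (F.reconstruction e).projY m = (e m).right := fun m => rfl
  let ι₁ : ↥R.lDeltaTheta →* ↥R.PiY := Subgroup.inclusion hlDT_PiY
  let f₀ : ↥R.lDeltaTheta →* Menv.Pi :=
    e.symm.toMulEquiv.toMonoidHom.comp ((CycEnvelope.algSection R.augY R.chi).comp ι₁)
  have hf₀e : ∀ t, e (f₀ t) = CycEnvelope.algSection R.augY R.chi (ι₁ t) := fun t =>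
    e.apply_symm_apply _
  have hf₀proj : ∀ t, (F.reconstruction e).projY (f₀ t) = ι₁ t := fun t => by
    rw [hprojY, hf₀e]; rfl
  have hf₀top : ∀ t, f₀ t ∈ T.envAtTheta.top := fun t => by
    rw [htop, hf₀proj]; exact t.2
  let f₁ : ↥R.lDeltaTheta →* ↥T.envAtTheta.top := f₀.codRestrict _ hf₀top
  let Sg : ↥R.lDeltaTheta →* T.envAtTheta.carrier :=
    (QuotientGroup.mk' (T.envAtTheta.bot.subgroupOf T.envAtTheta.top)).comp f₁
  have hSg_one : ∀ t : ↥R.lDeltaTheta, Mt.toTheta ((t : ↥C.Huu) : Mt.PiTemp) = 1 → Sg t = 1 := by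
    intro t ht
    change (QuotientGroup.mk (f₁ t) : T.envAtTheta.carrier) = 1
    rw [QuotientGroup.eq_one_iff, Subgroup.mem_subgroupOf]
    change f₀ t ∈ T.envAtTheta.bot
    rw [hbot, hf₀e]
    exact Subgroup.mem_map_of_mem _ (Subgroup.mem_subgroupOf.2 ((hmemK _).2 ht))
  have hSg_eq : ∀ t t' : ↥R.lDeltaTheta,
      Mt.toTheta ((t : ↥C.Huu) : Mt.PiTemp) = Mt.toTheta ((t' : ↥C.Huu) : Mt.PiTemp) → Sg t = Sg t' := by
    intro t t' h
    have h1 : Sg (t⁻¹ * t') = 1 := hSg_one _ (by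
      change Mt.toTheta (((t : ↥C.Huu) : Mt.PiTemp)⁻¹ * ((t' : ↥C.Huu) : Mt.PiTemp)) = 1
      rw [map_mul, map_inv, h, inv_mul_cancel])
    calc Sg t = Sg t * Sg (t⁻¹ * t') := by rw [h1, mul_one]
      _ = Sg t' := by rw [← map_mul, mul_inv_cancel_left]
  have hSg_mul : ∀ t t₁ t₂ : ↥R.lDeltaTheta, Mt.toTheta ((t : ↥C.Huu) : Mt.PiTemp) =
      Mt.toTheta ((t₁ : ↥C.Huu) : Mt.PiTemp) * Mt.toTheta ((t₂ : ↥C.Huu) : Mt.PiTemp) →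
        Sg t = Sg t₁ * Sg t₂ := fun t t₁ t₂ h => by
    rw [← map_mul]; exact hSg_eq _ _ (by rw [h, ← map_mul]; rfl)
  have hSg_proj : ∀ t : ↥R.lDeltaTheta, T.proj (Sg t) =
      (QuotientGroup.mk (⟨ι₁ t, t.2⟩ : ↥(F.reconstruction e).intCyc.top) :
        (F.reconstruction e).intCyc.carrier) := by
    intro t; change T.proj (QuotientGroup.mk (f₁ t)) = _
    rw [ThetaQuotientData.proj, QuotientGroup.map_mk]; congr 1; exact Subtype.ext (hf₀proj t)
  let ι₂ : ↥R.lDeltaTheta →* ↥R.PiYdd := Subgroup.inclusion hlDT_PiYdd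
  let g₀ : ↥R.lDeltaTheta →* Menv.Pi :=
    e.symm.toMulEquiv.toMonoidHom.comp ((R.toThetaEnvData.sTheta hη).comp ι₂)
  have hg₀e : ∀ t, e (g₀ t) = R.toThetaEnvData.sTheta hη (ι₂ t) := fun t => e.apply_symm_apply _
  have hg₀proj : ∀ t, (F.reconstruction e).projY (g₀ t) = ι₁ t := fun t => by
    rw [hprojY, hg₀e]; rfl
  have hg₀top : ∀ t, g₀ t ∈ T.envAtTheta.top := fun t => by
    rw [htop, hg₀proj]; exact t.2
  let g₁ : ↥R.lDeltaTheta →* ↥T.envAtTheta.top := g₀.codRestrict _ hg₀top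
  let SgΘ : ↥R.lDeltaTheta →* T.envAtTheta.carrier :=
    (QuotientGroup.mk' (T.envAtTheta.bot.subgroupOf T.envAtTheta.top)).comp g₁
  have hSgΘ_one : ∀ t : ↥R.lDeltaTheta, Mt.toTheta ((t : ↥C.Huu) : Mt.PiTemp) = 1 → SgΘ t = 1 := by
    intro t ht
    change (QuotientGroup.mk (g₁ t) : T.envAtTheta.carrier) = 1
    rw [QuotientGroup.eq_one_iff, Subgroup.mem_subgroupOf]
    change g₀ t ∈ T.envAtTheta.bot
    rw [hbot, hg₀e, ModelFrame.sTheta_eq_algSection_of_mem_thetaKer hη (ι₂ t) ((hmemK _).2 ht)]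
    exact Subgroup.mem_map_of_mem _ (Subgroup.mem_subgroupOf.2 ((hmemK _).2 ht))
  have hSgΘ_eq : ∀ t t' : ↥R.lDeltaTheta,
      Mt.toTheta ((t : ↥C.Huu) : Mt.PiTemp) = Mt.toTheta ((t' : ↥C.Huu) : Mt.PiTemp) →
        SgΘ t = SgΘ t' := by
    intro t t' h
    have h1 : SgΘ (t⁻¹ * t') = 1 := hSgΘ_one _ (by
      change Mt.toTheta (((t : ↥C.Huu) : Mt.PiTemp)⁻¹ * ((t' : ↥C.Huu) : Mt.PiTemp)) = 1
      rw [map_mul, map_inv, h, inv_mul_cancel])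
    calc SgΘ t = SgΘ t * SgΘ (t⁻¹ * t') := by rw [h1, mul_one]
      _ = SgΘ t' := by rw [← map_mul, mul_inv_cancel_left]
  have hSgΘ_proj : ∀ t : ↥R.lDeltaTheta, T.proj (SgΘ t) =
      (QuotientGroup.mk (⟨ι₁ t, t.2⟩ : ↥(F.reconstruction e).intCyc.top) :
        (F.reconstruction e).intCyc.carrier) := by
    intro t; change T.proj (QuotientGroup.mk (g₁ t)) = _
    rw [ThetaQuotientData.proj, QuotientGroup.map_mk]; congr 1; exact Subtype.ext (hg₀proj t)
  have hmk_eq : ∀ t t' : ↥R.lDeltaTheta,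
      (QuotientGroup.mk (⟨ι₁ t, t.2⟩ : ↥(F.reconstruction e).intCyc.top) :
        (F.reconstruction e).intCyc.carrier) =
      QuotientGroup.mk (⟨ι₁ t', t'.2⟩ : ↥(F.reconstruction e).intCyc.top) →
      Mt.toTheta ((t : ↥C.Huu) : Mt.PiTemp) = Mt.toTheta ((t' : ↥C.Huu) : Mt.PiTemp) := by
    intro t t' h
    rw [QuotientGroup.eq, Subgroup.mem_subgroupOf] at h
    have h' : ((t : ↥C.Huu)⁻¹ * (t' : ↥C.Huu)) ∈ R.thetaKer := h
    rw [hmemK] at h'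
    change Mt.toTheta (((t : ↥C.Huu) : Mt.PiTemp)⁻¹ * ((t' : ↥C.Huu) : Mt.PiTemp)) = 1 at h'
    rwa [map_mul, map_inv, inv_mul_eq_one] at h'
  have hxrep : ∀ a : (F.reconstruction e).lZ, ∃ x : ↥C.Huu,
      (QuotientGroup.mk x : ↥C.Huu ⧸ (F.reconstruction e).inclY.range) = a ∧
        Mt.aug (x : Mt.PiTemp) = 1 := by
    intro a
    obtain ⟨x₀, rfl⟩ := QuotientGroup.mk_surjective a
    obtain ⟨y, hy⟩ := ModelCyclotomes.augY_surjective R (R.aug x₀)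
    refine ⟨x₀ * (y : ↥C.Huu)⁻¹, ?_, ?_⟩
    · refine (QuotientGroup.eq.2 ?_).symm
      rw [← mul_assoc, inv_mul_cancel, one_mul]; exact inv_mem ⟨y, rfl⟩
    · rw [← haugR, MonoidHom.mem_ker, map_mul, map_inv, mul_inv_eq_one]
      exact hy.symm
  choose xrep hxrep_mk hxrep_aug using hxrep
  have hyrep : ∀ y : W.DeltaYell, ∃ b : ↥(F.reconstruction e).DeltaY,
      (QuotientGroup.mk b : W.DeltaYell) = y := fun y => QuotientGroup.mk_surjective y
  choose yrep hyrep_mk using hyrep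
  have hcm_mem : ∀ (x : ↥C.Huu), Mt.aug (x : Mt.PiTemp) = 1 →
      ∀ b : ↥(Mt.GtpY.subgroupOf C.Huu), Mt.aug ((b : ↥C.Huu) : Mt.PiTemp) = 1 →
        x * (b : ↥C.Huu) * x⁻¹ * (b : ↥C.Huu)⁻¹ ∈ R.lDeltaTheta := by
    intro x hx b hb
    refine (hcomm _).2 ⟨x, (haugR x).2 hx, (b : ↥C.Huu), ⟨b.2, (haugR _).2 hb⟩, 1, one_mem _, ?_⟩
    rw [mul_one]
  let cmR : (F.reconstruction e).lZ → W.DeltaYell → ↥R.lDeltaTheta := fun a y =>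
    ⟨xrep a * ((yrep y : ↥(Mt.GtpY.subgroupOf C.Huu)) : ↥C.Huu) * (xrep a)⁻¹ *
        (((yrep y : ↥(Mt.GtpY.subgroupOf C.Huu)) : ↥C.Huu))⁻¹,
      hcm_mem (xrep a) (hxrep_aug a) _ (hΔY (yrep y))⟩
  have θcm : ∀ x b : ↥C.Huu, Mt.toTheta (((x * b * x⁻¹ * b⁻¹ : ↥C.Huu)) : Mt.PiTemp) =
      Mt.toTheta (x : Mt.PiTemp) * Mt.toTheta (b : Mt.PiTemp) * (Mt.toTheta (x : Mt.PiTemp))⁻¹ *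
        (Mt.toTheta (b : Mt.PiTemp))⁻¹ := fun x b => by
    simp only [Subgroup.coe_mul, Subgroup.coe_inv, map_mul, map_inv]
  have hcmΔΘ : ∀ (x : ↥C.Huu), Mt.aug (x : Mt.PiTemp) = 1 →
      ∀ b : ↥(Mt.GtpY.subgroupOf C.Huu), Mt.aug ((b : ↥C.Huu) : Mt.PiTemp) = 1 →
        Mt.toTheta (x : Mt.PiTemp) * Mt.toTheta ((b : ↥C.Huu) : Mt.PiTemp) *
          (Mt.toTheta (x : Mt.PiTemp))⁻¹ * (Mt.toTheta ((b : ↥C.Huu) : Mt.PiTemp))⁻¹ ∈ Mt.DeltaTheta := by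
    intro x hx b hb; rw [← θcm]
    exact Mt.toThetaSetting.lDeltaTheta_le l ((hmemL _).1 (hcm_mem x hx b hb))
  have hrepX : ∀ (x x' : ↥C.Huu), Mt.aug (x : Mt.PiTemp) = 1 → Mt.aug (x' : Mt.PiTemp) = 1 →
      (QuotientGroup.mk x : ↥C.Huu ⧸ (F.reconstruction e).inclY.range) = QuotientGroup.mk x' →
      ∀ b : ↥(Mt.GtpY.subgroupOf C.Huu), Mt.aug ((b : ↥C.Huu) : Mt.PiTemp) = 1 →
        Mt.toTheta (((x * b * x⁻¹ * (b : ↥C.Huu)⁻¹ : ↥C.Huu)) : Mt.PiTemp) =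
          Mt.toTheta (((x' * b * x'⁻¹ * (b : ↥C.Huu)⁻¹ : ↥C.Huu)) : Mt.PiTemp) := by
    intro x x' hx hx' hxx' b hb
    rw [QuotientGroup.eq] at hxx'
    obtain ⟨δ, hδ⟩ := hxx'
    have hδY : ((δ : ↥C.Huu) : Mt.PiTemp) ∈ Mt.GtpY := Subgroup.mem_subgroupOf.1 δ.2
    have hx'eq : x' = x * (δ : ↥C.Huu) := by
      have : (δ : ↥C.Huu) = x⁻¹ * x' := hδ
      rw [this, mul_inv_cancel_left]
    have hδaug : Mt.aug ((δ : ↥C.Huu) : Mt.PiTemp) = 1 := by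
      have : (δ : ↥C.Huu) = x⁻¹ * x' := hδ
      rw [this, Subgroup.coe_mul, Subgroup.coe_inv, map_mul, map_inv, hx, hx', inv_one, one_mul]
    have hδΘ : Mt.toTheta ((δ : ↥C.Huu) : Mt.PiTemp) ∈ Mt.DtpYTheta :=
      Subgroup.mem_map_of_mem _ ⟨hδY, hδaug⟩
    rw [hx'eq, θcm, θcm, Subgroup.coe_mul, map_mul]
    exact (conjComm_central_mul_left _ _ _ (hYab _ hδΘ _ (hθY b hb))).symm
  have hrepY : ∀ (x : ↥C.Huu), Mt.aug (x : Mt.PiTemp) = 1 →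
      ∀ b b' : ↥(F.reconstruction e).DeltaY, (QuotientGroup.mk b : W.DeltaYell) = QuotientGroup.mk b' →
        Mt.toTheta (((x * ((b : ↥(Mt.GtpY.subgroupOf C.Huu)) : ↥C.Huu) * x⁻¹ *
            (((b : ↥(Mt.GtpY.subgroupOf C.Huu)) : ↥C.Huu))⁻¹ : ↥C.Huu)) : Mt.PiTemp) =
          Mt.toTheta (((x * ((b' : ↥(Mt.GtpY.subgroupOf C.Huu)) : ↥C.Huu) * x⁻¹ *
            (((b' : ↥(Mt.GtpY.subgroupOf C.Huu)) : ↥C.Huu))⁻¹ : ↥C.Huu)) : Mt.PiTemp) := by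
    intro x hx b b' hbb'
    rw [QuotientGroup.eq, Subgroup.mem_subgroupOf, hWker, Subgroup.mem_comap, MonoidHom.mem_ker] at hbb'
    have hc : Mt.toTheta ((((b : ↥(Mt.GtpY.subgroupOf C.Huu)) : ↥C.Huu) : Mt.PiTemp)⁻¹ *
        (((b' : ↥(Mt.GtpY.subgroupOf C.Huu)) : ↥C.Huu) : Mt.PiTemp)) ∈ Mt.DeltaTheta := by
      change Mt.thetaToEll _ = 1; exact hbb'
    set β := Mt.toTheta ((((b : ↥(Mt.GtpY.subgroupOf C.Huu)) : ↥C.Huu) : Mt.PiTemp)) with hβ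
    set β' := Mt.toTheta ((((b' : ↥(Mt.GtpY.subgroupOf C.Huu)) : ↥C.Huu) : Mt.PiTemp)) with hβ'
    have hβ'eq : β' = β * (β⁻¹ * β') := by rw [mul_inv_cancel_left]
    rw [θcm, θcm, ← hβ, ← hβ', hβ'eq]
    refine (conjComm_mul_central_right _ _ _ ?_).symm
    rw [map_mul, map_inv] at hc; exact hcent _ hc _ (inv_mem (hθΔ x hx))
  have hle : Subgroup.closure
      (Set.range fun q : (F.reconstruction e).lZ × W.DeltaYell => Sg (cmR q.1 q.2)) ≤ Sg.range := by
    rw [Subgroup.closure_le]; rintro _ ⟨q, rfl⟩; exact ⟨cmR q.1 q.2, rfl⟩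
  have hbijΘ : Set.BijOn T.proj (SgΘ.range : Subgroup T.envAtTheta.carrier) Set.univ := by
    refine ⟨fun _ _ => Set.mem_univ _, ?_, ?_⟩
    · rintro _ ⟨t₁, rfl⟩ _ ⟨t₂, rfl⟩ h
      rw [hSgΘ_proj, hSgΘ_proj] at h; exact hSgΘ_eq _ _ (hmk_eq _ _ h)
    · intro c _
      obtain ⟨g, rfl⟩ := QuotientGroup.mk_surjective c
      refine ⟨SgΘ ⟨((g : ↥R.PiY) : ↥C.Huu), g.2⟩, ⟨_, rfl⟩, ?_⟩
      rw [hSgΘ_proj]; rfl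
  have hbijA : Set.BijOn T.proj (Subgroup.closure
      (Set.range fun q : (F.reconstruction e).lZ × W.DeltaYell => Sg (cmR q.1 q.2))) Set.univ := by
    refine ⟨fun _ _ => Set.mem_univ _, ?_, ?_⟩
    · intro s₁ hs₁ s₂ hs₂ h
      obtain ⟨t₁, rfl⟩ := hle hs₁; obtain ⟨t₂, rfl⟩ := hle hs₂
      rw [hSg_proj, hSg_proj] at h; exact hSg_eq _ _ (hmk_eq _ _ h)
    · intro c _
      obtain ⟨g, rfl⟩ := QuotientGroup.mk_surjective c
      obtain ⟨z, hz, b, hb, k, hk, hg⟩ := (hcomm ((g : ↥R.PiY) : ↥C.Huu)).1 g.2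
      have hzaug : Mt.aug (z : Mt.PiTemp) = 1 := (haugR z).1 hz
      have hbaug : Mt.aug (b : Mt.PiTemp) = 1 := (haugR b).1 hb.2
      let bY : ↥(Mt.GtpY.subgroupOf C.Huu) := ⟨b, hb.1⟩
      have hbY : bY ∈ (F.reconstruction e).DeltaY :=
        (mem_deltaY_reconstruction_iff C μ hC hS h15 L F e bY).2 hbaug
      let a : (F.reconstruction e).lZ := (QuotientGroup.mk z : ↥C.Huu ⧸ (F.reconstruction e).inclY.range)
      let y : W.DeltaYell := QuotientGroup.mk ⟨bY, hbY⟩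
      refine ⟨Sg (cmR a y), Subgroup.subset_closure ⟨(a, y), rfl⟩, ?_⟩
      rw [hSg_proj]; apply QuotientGroup.eq.2; rw [Subgroup.mem_subgroupOf]
      change ((cmR a y : ↥R.lDeltaTheta) : ↥C.Huu)⁻¹ * ((g : ↥R.PiY) : ↥C.Huu) ∈ R.thetaKer
      rw [hmemK, Subgroup.coe_mul, Subgroup.coe_inv, map_mul, map_inv, inv_mul_eq_one]
      have h1 := hrepX (xrep a) z (hxrep_aug a) hzaug (hxrep_mk a) _ (hΔY (yrep y))
      have h2 := hrepY z hzaug (yrep y) ⟨bY, hbY⟩ (hyrep_mk y)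
      change Mt.toTheta (((xrep a * ((yrep y : ↥(Mt.GtpY.subgroupOf C.Huu)) : ↥C.Huu) * (xrep a)⁻¹ *
          (((yrep y : ↥(Mt.GtpY.subgroupOf C.Huu)) : ↥C.Huu))⁻¹ : ↥C.Huu)) : Mt.PiTemp) = _
      have hk1 : Mt.toTheta (k : Mt.PiTemp) = 1 := (hmemK k).1 hk
      have hg' : Mt.toTheta (((g : ↥R.PiY) : ↥C.Huu) : Mt.PiTemp) =
          Mt.toTheta (z : Mt.PiTemp) * Mt.toTheta (b : Mt.PiTemp) * (Mt.toTheta (z : Mt.PiTemp))⁻¹ *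
            (Mt.toTheta (b : Mt.PiTemp))⁻¹ := by
        rw [hg]
        change Mt.toTheta ((z : Mt.PiTemp) * b * (z : Mt.PiTemp)⁻¹ * (b : Mt.PiTemp)⁻¹ * k) = _
        rw [map_mul, map_mul, map_mul, map_mul, map_inv, map_inv, hk1, mul_one]
      rw [h1, h2, θcm, hg']
  obtain ⟨ψ⟩ := (F.reconstruction e).ext_iso_ZMod
  have hcommExt : ∀ m m' : ↥(F.reconstruction e).extCyc, m * m' = m' * m := fun m m' =>
    ψ.injective (by rw [map_mul, map_mul, mul_comm])
  let invE : ↥(F.reconstruction e).extCyc ≃* ↥(F.reconstruction e).extCyc :=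
    { toFun := fun m => m⁻¹, invFun := fun m => m⁻¹, left_inv := fun m => inv_inv m, right_inv := fun m => inv_inv m
      map_mul' := fun m m' => by rw [mul_inv_rev, hcommExt] }
  let C' : CyclotomicRigidity (F.reconstruction e) :=
    { iso := (F.cyclotomicRigidity e).iso.trans invE
      equivariant := fun x c => by
        change ((F.cyclotomicRigidity e).iso _)⁻¹ =
          (F.reconstruction e).extAct x (((F.cyclotomicRigidity e).iso _)⁻¹)
        rw [(F.cyclotomicRigidity e).equivariant, map_inv] }
  have hmtop : ∀ m : ↥(F.reconstruction e).extCyc, ((m : Menv.Pi))⁻¹ ∈ T.envAtTheta.top := fun m => by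
    rw [htop, map_inv, (MonoidHom.mem_ker).1 m.2, inv_one, OneMemClass.coe_one]
    exact one_mem _
  have hkey : ∀ t : ↥R.lDeltaTheta,
      (QuotientGroup.mk (⟨(((F.cyclotomicRigidity e).iso
          (QuotientGroup.mk (QuotientGroup.mk (⟨ι₁ t, t.2⟩ : ↥(F.reconstruction e).intCyc.top) :
            (F.reconstruction e).intCyc.carrier)) : ↥(F.reconstruction e).extCyc) : Menv.Pi)⁻¹, hmtop _⟩ :
          ↥T.envAtTheta.top) : T.envAtTheta.carrier) = SgΘ t * (Sg t)⁻¹ := by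
    intro t
    change _ = (QuotientGroup.mk (g₁ t) : T.envAtTheta.carrier) * (QuotientGroup.mk (f₁ t) : T.envAtTheta.carrier)⁻¹
    rw [← QuotientGroup.mk_inv, ← QuotientGroup.mk_mul]
    congr 1; apply Subtype.ext; change _ = g₀ t * (f₀ t)⁻¹
    exact (sTheta_mul_sAlg_inv_eq_iso_inv F e hη t).symm
  have hover : ∀ (a : (F.reconstruction e).intCyc.carrier) (t₁ t₂ : ↥R.lDeltaTheta),
      T.proj (SgΘ t₁) = a → T.proj (Sg t₂) = a →
        a = QuotientGroup.mk (⟨ι₁ t₁, t₁.2⟩ : ↥(F.reconstruction e).intCyc.top) ∧ Sg t₂ = Sg t₁ := by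
    intro a t₁ t₂ h₁ h₂
    refine ⟨h₁.symm.trans (hSgΘ_proj t₁), hSg_eq _ _ (hmk_eq _ _ ?_)⟩
    rw [← hSg_proj, h₂, ← hSgΘ_proj, h₁]
  have hmulL : ∀ (a a' : (F.reconstruction e).lZ) (y : W.DeltaYell),
      Sg (cmR (a * a') y) = Sg (cmR a y) * Sg (cmR a' y) := by
    intro a a' y
    apply hSg_mul
    have haa' : Mt.aug ((xrep a * xrep a' : ↥C.Huu) : Mt.PiTemp) = 1 := by
      rw [Subgroup.coe_mul, map_mul, hxrep_aug, hxrep_aug, mul_one]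
    have hmk : (QuotientGroup.mk (xrep (a * a')) : ↥C.Huu ⧸ (F.reconstruction e).inclY.range) =
        QuotientGroup.mk (xrep a * xrep a') := by
      rw [QuotientGroup.mk_mul, hxrep_mk, hxrep_mk, hxrep_mk]
      rfl
    rw [hrepX (xrep (a * a')) (xrep a * xrep a') (hxrep_aug _) haa' hmk _ (hΔY (yrep y)), θcm,
      θcm (xrep a) (((yrep y : ↥(F.reconstruction e).DeltaY) : ↥(Mt.GtpY.subgroupOf C.Huu)) : ↥C.Huu),
      θcm (xrep a') (((yrep y : ↥(F.reconstruction e).DeltaY) : ↥(Mt.GtpY.subgroupOf C.Huu)) : ↥C.Huu),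
      Subgroup.coe_mul, map_mul]
    refine conjComm_mul_left _ _ _ ?_ ?_
    · exact (hcent _ (hcmΔΘ (xrep a') (hxrep_aug a') _ (hΔY (yrep y))) _ (hθΔ _ (hxrep_aug a))).symm
    · exact hcommΘ _ (hcmΔΘ (xrep a) (hxrep_aug a) _ (hΔY (yrep y))) _
        (hcmΔΘ (xrep a') (hxrep_aug a') _ (hΔY (yrep y)))
  have hmulR : ∀ (a : (F.reconstruction e).lZ) (y y' : W.DeltaYell),
      Sg (cmR a (y * y')) = Sg (cmR a y) * Sg (cmR a y') := by
    intro a y y'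
    apply hSg_mul
    have hmk : (QuotientGroup.mk (yrep (y * y')) : W.DeltaYell) = QuotientGroup.mk (yrep y * yrep y') := by
      rw [QuotientGroup.mk_mul, hyrep_mk, hyrep_mk, hyrep_mk]
    rw [hrepY (xrep a) (hxrep_aug a) (yrep (y * y')) (yrep y * yrep y') hmk, θcm,
      θcm (xrep a) (((yrep y : ↥(F.reconstruction e).DeltaY) : ↥(Mt.GtpY.subgroupOf C.Huu)) : ↥C.Huu),
      θcm (xrep a) (((yrep y' : ↥(F.reconstruction e).DeltaY) : ↥(Mt.GtpY.subgroupOf C.Huu)) : ↥C.Huu)]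
    have e3 : ((((yrep y * yrep y' : ↥(F.reconstruction e).DeltaY) : ↥(Mt.GtpY.subgroupOf C.Huu)) :
        ↥C.Huu) : Mt.PiTemp) =
        (((yrep y : ↥(Mt.GtpY.subgroupOf C.Huu)) : ↥C.Huu) : Mt.PiTemp) *
          (((yrep y' : ↥(Mt.GtpY.subgroupOf C.Huu)) : ↥C.Huu) : Mt.PiTemp) := rfl
    rw [e3, map_mul]
    refine conjComm_mul_right _ _ _ ?_
    exact (hcent _ (hcmΔΘ (xrep a) (hxrep_aug a) _ (hΔY (yrep y'))) _
      (hYΔ (hθY _ (hΔY (yrep y))))).symm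
  let Sec : TwoSections T W :=
    { sTheta := SgΘ.range
      sAlg := Subgroup.closure (Set.range fun q : (F.reconstruction e).lZ × W.DeltaYell => Sg (cmR q.1 q.2))
      sTheta_bijOn := hbijΘ, sAlg_bijOn := hbijA, extCyc_inf_bot := hText, commutator := fun a y => Sg (cmR a y)
      commutator_mul_left := hmulL, commutator_mul_right := hmulR
      lZ_iso := ModelFrame.nonempty_lZ_mulEquiv_int F e
      sAlg_eq_closure := rfl }
  have hSecΘ : Sec.sTheta = SgΘ.range := rfl
  have hSecA : Sec.sAlg =
      Subgroup.closure (Set.range fun q : (F.reconstruction e).lZ × W.DeltaYell => Sg (cmR q.1 q.2)) := rfl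
  have hdiffC' : rigidity_is_difference Sec C' := by
    intro a t s ht hs hta hsa
    rw [hSecΘ] at ht; rw [hSecA] at hs
    obtain ⟨t₁, rfl⟩ := ht; obtain ⟨t₂, rfl⟩ := hle hs
    obtain ⟨ha, h21⟩ := hover a t₁ t₂ hta hsa
    subst ha; rw [h21]; exact ⟨C'.iso _, rfl, hkey t₁⟩
  refine ⟨T, Sec, C', hTsec, fun c => rfl, hdiffC', fun g => ⟨hg₀top g, ?_⟩, fun s hs => ?_⟩
  · rw [hSecΘ]; exact ⟨g, rfl⟩
  · rw [hSecA] at hs; obtain ⟨t, rfl⟩ := hle hs; exact ⟨t, hf₀top t, rfl⟩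

end ModelFrame
end Literature.IUT.HodgeArakelov
end
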